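import Mathlib
import Summits.QuantumFields.BalabanUV.T4Continuum.Support.SliceTorusTower

/-!
# T⁴ programme, node NE3 — the slice-operator TORUS MODEL, file 4/4: KERNEL FORM, the PRINTED FAMILY STATEMENTS
# BY NAME, and THE NE3 SKELETON END TO END

Series purpose, dictionary and printed wordings [R]: header of `SliceTorusBlocks` (file 1/4); B9 Theorem 3.1 as certified
in the header of `T4SliceOperatorData` (p. 397): «There exist positive constants M₁, δ₀, a₀, B₀ dependent on d and L only
… such that for M ≥ M₁ and for an arbitrary configuration U satisfying the regularity condition (3.35) with Mα₀ ≤ a₀, the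
operator G′(U) (a = 1) satisfies the inequalities» (3.42)–(3.47); p. 399: «the constants in the formulations of both
theorems do not depend on the sequence {Ω_j}».  THIS FILE:
 (1) §5 `sliceKernel_bound_torus_of_kernelBounds`: King's (3.63) shape for every slice from NO `B9` structure at all —
     per level, the cube-localised row masses of `G_j` (`≤ B₀(L^j)²e^{−δ₀dist}`: (3.42) item 0 in kernel form), the
     cube-localised column masses of `G_j·D` (`≤ B₀L^je^{−δ₀dist}`: item 1 for the transpose, Hermiticity [model]) and
     the entries of `N_j` (`≤ C₃(L^j)^{−(d+2)}e^{−(δ₁/2)dist}`: (3.49) item `DPD*` in kernel form), any `dist j ≥ nbd j`;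
     via the one-configuration background `unitBg` and the carriers `![G_j, (G_j·D)ᵀ, 0, 0]`, `![0, 0, 0, N_j]`.
 (2) §5b `sliceKernel_bound_torus_of_printedStatements`: THE PRINTED FAMILY STATEMENTS BY NAME — hypotheses
     `B9.Thm31Printed c35 (torusGeom … M dist) Bg (fun j => matrixFamily … (A j))` and `B9.Stmt349Printed d c35 …` (as
     typed and cite-tagged by the literature seat, family index = the level `j`) ⇒ thresholds `M₁, a₀ > 0` and a decay
     ceiling `δ⋆ = min(δ₀, δ₁/2) > 0` exist such that for every `0 ≤ δ < δ⋆` some `C ≥ 0` bounds every slice in King's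
     shape AS SOON AS `M₁ ≤ M`, `Mα₀ ≤ a₀` and every `U j` lies in the class (3.35) — Bałaban's own conditions, visible
     in the type.
 (3) §7 `ne3Shape_torus_of_printedStatements`: THE NE3 SKELETON END TO END in one type — level `k` of the run on the
     torus `(ℤ/NL^k)^d` (`n := k`), slices = the resolvent slices of the auxiliary propagators; STABILITY hypotheses =
     `B9.Thm31Printed` / `B9.Stmt349Printed` for the family indexed by `(k, V, j)` (ONE threshold block for the whole
     family), the identifications, the operator model, `hbd`; CONSISTENCY hypotheses = exactly those of
     `T4SliceTelescoping.ne3Shape_of_slices_rpow` (generations 7/8, unchanged: face sets with diameter / shell-count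
     bounds, the readings `z dl sig blk lam t osc nrm pair` with their located inequalities, `OneStepCorrectionRate`) in
     the integer metric `npl1` (`hzero`, `htri` proved in file 1); CONCLUSION: printed thresholds `M₁, a₀ > 0` exist such
     that once `M₁ ≤ M`, `Mα₀ ≤ a₀` and every background `U k V j` (`V ∈ dom`) is in the class (3.35), `NE3Shape R C′
     (L^{−a})` for some `C′`.
WHAT REMAINS (the located gap of the lineage = the hypotheses of `ne3Shape_torus_of_printedStatements`): on the stability
side, per `(k, V, j ≤ k+1)`, that the printed statements HOLD for the family of auxiliary propagators `G⁽ʲ⁾` of the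
resolvent telescoping and the gauge-fixing kernels — the READING (I′)/(I″) of B9 Theorem 3.1 / 3.3 / (3.49) for the
domain sequence stopping at level `j` on a background in the class (3.35), with its thresholds, the domination `d(y,y′) ≥
nbd` of B9's weighted distance ((2.36) of B6) and the operator model `hK` — HYPOTHESES, never discharged by citation; and
the consistency side (unchanged since generation 8).

Honest framing (all four files): finite-T⁴ ultraviolet bookkeeping about MINIMISERS (rung (B)+1 of the cell's ladder); no
conditional of the cell (`BetaPertH`, (B), (B^μ)) is used or hidden; nothing bears on infinite volume, a mass gap, or the
Clay problem; NE3 is NOT proved — the value is a typed skeleton with the gap located (the hypotheses of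
`SliceTorusSkeleton.ne3Shape_torus_of_printedStatements`).  ABSOLUTE RULE of the cell kept: no internally-minted statement
enters as a cited fact; B9's theorems enter only as HYPOTHESES of the tree's typed, cite-tagged shapes; the manuscripts
under audit are not cited for any disputed step.  No `sorry`, no axioms beyond Mathlib's; integer/real arithmetic, finite
sums and sups are [folklore]; every [model] sentence is dictionary, never a hypothesis discharged by citation.  PLACEMENT
(human rule 2026-08-19): new cell work lives under `Summits/QuantumFields/BalabanUV/`; this series imports the lineage's
earlier leaves where they landed (`Literature.….Balaban1983to89.T4SliceOperatorData` v1.1 p193857, `B12Decay510Torus`)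
and moves nothing.  Records: `t4/T4-EST-U1b-OSC.md` v1.22 (RESULTS 28, 29), `t4/T4-EST-NE3-P1.md` v2.20, GAPS
G-ne3p1-35/36 of the cell `pub-balaban` (HOME `run/shared/lean/pub/pub-balaban/`).
-/

noncomputable section

open Finset Real

namespace Summit.QuantumFields.BalabanUV.T4Continuum.SliceTorusSkeleton

open Literature.MathematicalPhysics.QuantumFieldTheory.Balaban1983to89
open Literature.MathematicalPhysics.QuantumFieldTheory.Balaban1983to89.TreeLengthTorus (TPt)
open Literature.MathematicalPhysics.QuantumFieldTheory.Balaban1983to89.B12Decay510Torus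
  (pabs pabs_eq_natAbs pabs_nonneg pabs_zero exists_eq_add_mul_of_cast_eq pabs_le_abs_of_cast_eq
    vmaVec vmaVec_injective pl1 pl1_eq_sum pl1_nonneg pl1_sub_comm pl1_sub_triangle)
open Literature.MathematicalPhysics.QuantumFieldTheory.Balaban1983to89.T4SliceTelescoping
  (sliceKernel sliceConst ne3Shape_of_slices_rpow)
open Literature.MathematicalPhysics.QuantumFieldTheory.Balaban1983to89.T4EtaRateMin (Readings NE3Shape)
open Literature.MathematicalPhysics.QuantumFieldTheory.Balaban1983to89.T4FixedPointResponse (OneStepCorrectionRate)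
open Literature.MathematicalPhysics.QuantumFieldTheory.Balaban1983to89.T4SliceOperatorData
open Summit.QuantumFields.BalabanUV.T4Continuum.SliceTorusBlocks Summit.QuantumFields.BalabanUV.T4Continuum.SliceTorusBlockModel Summit.QuantumFields.BalabanUV.T4Continuum.SliceTorusTower

/-! ## §5  KERNEL FORM: the same conclusion from the cube-localised row masses of `G_j`, the column masses of
`G_j·D` and the entries of `N_j` — (3.42) items 0, 1 and (3.49) item 3 READ AS KERNEL BOUNDS, nothing else -/
section KernelForm

/-- The background structure with ONE configuration (backgrounds are immaterial once the matrices are given). [model] [folklore] -/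
def unitBg : B9.Backgrounds where
  Cfg := PUnit
  one := PUnit.unit
  mul := fun _ _ => PUnit.unit
  Reg335 := fun _ _ _ => True
  Reg336 := fun _ _ _ => True
  Cplx337 := fun _ _ _ => True
  Cplx338 := fun _ _ _ => True

variable (d n N L : ℕ) [NeZero N] [NeZero L]

/-- **THE SLICE BOUNDS `hg` ON THE TORUS FROM KERNEL-FORM BOUNDS OF PRINTED TYPE.**  Hypotheses, per level `j` and
with LEVEL-FREE constants: (3.42) item 0 in kernel form for the auxiliary propagator — row masses on level-`j` blocks
`Σ_{z∈y₁}|G_j(x,z)| ≤ B₀(L^j)²e^{−δ₀·dist(cube x, y₁)}`; (3.42) item 1 in kernel form for `(G_j·D)ᵀ` (Hermiticity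
[model]) — column masses `Σ_{z∈y₁}|(G_j·D)(z,x)| ≤ B₀L^je^{−δ₀·dist(cube x, y₁)}`; (3.49) item 3 in kernel form for the
gauge-fixing kernel — `|N_j(z,w)| ≤ C₃(L^j)^{−(d+2)}e^{−(δ₁/2)·dist(cube z, cube w)}` (`dist j` any level-indexed site
distance dominating the integer block distance, `hbd` — B9's `d(y,y′)` once typed; `nbdDist` itself qualifies); the
operator model
`K_j = massKernel_j + N_j`.  CONCLUSION: King's (3.63) shape for every slice with `C = C_A(1 + C_A·C_P)`,
`C_A = printedCA B₀ δ₀ δ d 2^d d`, `C_P = printedCP a C₃ δ₁ δ L d d`.  Proof: the kernel-form bounds ARE the typed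
(3.42)/(3.49) of the matrix carriers (`ineq342_matrixFamily_of_rowBounds`, `ineq349_fineKernelOf_of_entryBounds`), then
`sliceKernel_bound_torus_of_printedType`.  HONEST: that B9 Thm 3.1/3.3 and (3.49) yield these kernel-form bounds for
the real auxiliary propagators is the READING (I′)/(I″) of the records (with its thresholds and the identification
`d(y,y′) ≥ nbd`), a hypothesis of the NE3 node — not discharged here. [folklore] -/
theorem sliceKernel_bound_torus_of_kernelBounds
    (G Ng K : ℕ → Matrix (TPt d (N * L ^ n)) (TPt d (N * L ^ n)) ℝ)
    (D : Matrix (TPt d (N * L ^ n)) (TPt d (N * L ^ n)) ℝ)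
    (τ : ℕ → TPt d (N * L ^ n) → TPt d (N * L ^ n) → ℝ) (am : ℕ → ℝ)
    (dist : ∀ j : ℕ, TPt d (levM n N L j) → TPt d (levM n N L j) → ℝ) {B₀ δ₀ C₃ δ₁ δ a : ℝ}
    (hd : 1 ≤ d) (hB₀ : 0 ≤ B₀) (hC₃ : 0 ≤ C₃) (hδ : 0 ≤ δ) (hδ₀ : δ < δ₀) (hδ₁ : δ ≤ δ₁ / 2) (ha : 0 ≤ a)
    (hbd : ∀ j y y₁, (nbd d n N L j y y₁ : ℝ) ≤ dist j y y₁)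
    (hG : ∀ j x y₁, ∑ z ∈ Finset.univ.filter (fun z => cube d n N L j z = y₁), |G j x z|
      ≤ B₀ * ((L : ℝ) ^ j) ^ 2 * Real.exp (-(δ₀ * dist j (cube d n N L j x) y₁)))
    (hGD : ∀ j x y₁, ∑ z ∈ Finset.univ.filter (fun z => cube d n N L j z = y₁), |(G j * D) z x|
      ≤ B₀ * (L : ℝ) ^ j * Real.exp (-(δ₀ * dist j (cube d n N L j x) y₁)))
    (hNg : ∀ j z w, |Ng j z w| ≤ C₃ / ((L : ℝ) ^ j) ^ (d + 2)
      * Real.exp (-(δ₁ / 2 * dist j (cube d n N L j z) (cube d n N L j w))))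
    (hτ : ∀ j z w, |τ j z w| ≤ 1) (ham : ∀ j, 0 ≤ am j ∧ am j ≤ a)
    (hK : ∀ j, K j = massKernel (cube d n N L j) (τ j) (am j / ((L : ℝ) ^ j) ^ (d + 2)) + Ng j) :
    ∀ i x y, |sliceKernel G K D i x y|
      ≤ printedCA B₀ δ₀ δ d ((2 : ℝ) ^ d) d * (1 + printedCA B₀ δ₀ δ d ((2 : ℝ) ^ d) d * printedCP a C₃ δ₁ δ L d d)
        * (Real.exp (-(δ * (rho d n N L x y / (L : ℝ) ^ i))) / ((L : ℝ) ^ i) ^ (d - 1)) := by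
  have hL : (1 : ℝ) ≤ L := by exact_mod_cast one_le_L L
  have hL0 : (0 : ℝ) < L := by linarith
  set A : ∀ j : ℕ, Fin 4 → (unitBg).Cfg → Matrix (TPt d (N * L ^ n)) (TPt d (N * L ^ n)) ℝ :=
    fun j m _ => ![G j, (G j * D).transpose, 0, 0] m with hA
  set F : ∀ j : ℕ, Fin 4 → (unitBg).Cfg → Matrix (TPt d (N * L ^ n)) (TPt d (N * L ^ n)) ℝ :=
    fun j m _ => ![0, 0, 0, Ng j] m with hF
  refine sliceKernel_bound_torus_of_printedType d n N L 0 dist (fun _ => unitBg) (fun _ => PUnit.unit) A F G Ng K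
    D τ am hd hB₀ hC₃ hδ hδ₀ hδ₁ ha hbd (fun j => rfl) (fun j => rfl) (fun j => rfl) (fun j => ?_) (fun j => ?_)
    hτ ham hK
  · refine ineq342_matrixFamily_of_rowBounds _ _ j 0 (A j) PUnit.unit hB₀ hL0.le fun m x y₁ => ?_
    have hLj : (0 : ℝ) ≤ (L : ℝ) ^ j := pow_nonneg hL0.le j
    fin_cases m
    · show ∑ z ∈ Finset.univ.filter (fun z => cube d n N L j z = y₁), |G j x z|
        ≤ B₀ * ((L : ℝ) ^ j) ^ 2 * Real.exp (-(δ₀ * dist j (cube d n N L j x) y₁))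
      exact hG j x y₁
    · show ∑ z ∈ Finset.univ.filter (fun z => cube d n N L j z = y₁), |(G j * D) z x|
        ≤ B₀ * (L : ℝ) ^ j * Real.exp (-(δ₀ * dist j (cube d n N L j x) y₁))
      exact hGD j x y₁
    · show ∑ z ∈ Finset.univ.filter (fun z => cube d n N L j z = y₁), |(0 : Matrix _ _ ℝ) x z|
        ≤ B₀ * (L : ℝ) ^ j * Real.exp (-(δ₀ * dist j (cube d n N L j x) y₁))
      simp only [Matrix.zero_apply, abs_zero, Finset.sum_const_zero]
      positivity
    · show ∑ z ∈ Finset.univ.filter (fun z => cube d n N L j z = y₁), |(0 : Matrix _ _ ℝ) x z|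
        ≤ B₀ * 1 * Real.exp (-(δ₀ * dist j (cube d n N L j x) y₁))
      simp only [Matrix.zero_apply, abs_zero, Finset.sum_const_zero]
      positivity
  · refine ineq349_fineKernelOf_of_entryBounds _ _ j 0 (F j) PUnit.unit hC₃ hL0 fun m z w => ?_
    have hLj : (0 : ℝ) < (L : ℝ) ^ j := pow_pos hL0 j
    have hr : (0 : ℝ) ≤ ((L : ℝ) ^ j) ^ (-(d : ℝ)) := Real.rpow_nonneg hLj.le _
    fin_cases m
    · show |(0 : Matrix _ _ ℝ) z w| ≤ C₃ * 1 * ((L : ℝ) ^ j) ^ (-(d : ℝ))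
        * Real.exp (-(δ₁ / 2 * dist j (cube d n N L j z) (cube d n N L j w)))
      rw [Matrix.zero_apply, abs_zero]; positivity
    · show |(0 : Matrix _ _ ℝ) z w| ≤ C₃ * ((L : ℝ) ^ j)⁻¹ * ((L : ℝ) ^ j) ^ (-(d : ℝ))
        * Real.exp (-(δ₁ / 2 * dist j (cube d n N L j z) (cube d n N L j w)))
      rw [Matrix.zero_apply, abs_zero]; positivity
    · show |(0 : Matrix _ _ ℝ) z w| ≤ C₃ * ((L : ℝ) ^ j)⁻¹ * ((L : ℝ) ^ j) ^ (-(d : ℝ))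
        * Real.exp (-(δ₁ / 2 * dist j (cube d n N L j z) (cube d n N L j w)))
      rw [Matrix.zero_apply, abs_zero]; positivity
    · show |Ng j z w| ≤ C₃ * ((L : ℝ) ^ j)⁻¹ ^ 2 * ((L : ℝ) ^ j) ^ (-(d : ℝ))
        * Real.exp (-(δ₁ / 2 * dist j (cube d n N L j z) (cube d n N L j w)))
      have hs0 : (L : ℝ) ^ j ≠ 0 := hLj.ne'
      have key : C₃ * ((L : ℝ) ^ j)⁻¹ ^ 2 * ((L : ℝ) ^ j) ^ (-(d : ℝ)) = C₃ / ((L : ℝ) ^ j) ^ (d + 2) := by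
        rw [Real.rpow_neg hLj.le, Real.rpow_natCast, eq_div_iff (pow_ne_zero _ hs0)]
        calc C₃ * ((L : ℝ) ^ j)⁻¹ ^ 2 * (((L : ℝ) ^ j) ^ d)⁻¹ * ((L : ℝ) ^ j) ^ (d + 2)
            = C₃ * ((((L : ℝ) ^ j)⁻¹ * (L : ℝ) ^ j) ^ 2 * ((((L : ℝ) ^ j) ^ d)⁻¹ * ((L : ℝ) ^ j) ^ d)) := by ring
          _ = C₃ := by rw [inv_mul_cancel₀ hs0, inv_mul_cancel₀ (pow_ne_zero _ hs0)]; ring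
      rw [key]
      exact hNg j z w

end KernelForm

/-! ## §5b  THE PRINTED FAMILY STATEMENTS BY NAME: B9 Theorem 3.1 (`B9.Thm31Printed`) and the (3.49) claim
(`B9.Stmt349Printed`) — the literature seat's typed, cite-tagged statements — INSTANTIATED on the model carriers give
the slice bounds, with Bałaban's thresholds `M ≥ M₁`, `Mα₀ ≤ a₀` and the regularity class (3.35) appearing as the
explicit hypotheses they are in print -/
section PrintedStatements

variable (d n N L : ℕ) [NeZero N] [NeZero L]

/-- **THE SLICE BOUNDS FROM THE PRINTED STATEMENTS, BY NAME.**  Family index = the level `j : ℕ` (one torus,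
one `M`); carriers = `matrixFamily (A j)` / `fineKernelOf (F j)` over the level-`j` block geometry `torusGeom … M dist j` (free dominating site distance `dist`, `hbd`).
HYPOTHESES: `hT31 : B9.Thm31Printed c35 (torusGeom d n N L M dist) Bg (fun j => matrixFamily … (A j))` — Theorem 3.1
AS TYPED BY THE LITERATURE SEAT (∃ M₁ δ₀ a₀ B₀ …, ∀ j, M₁ ≤ M → ∀ α₀ > 0, Mα₀ ≤ a₀ → ∀ U ∈ (3.35), (3.42)–(3.47))
for THIS family, and `hT349 : B9.Stmt349Printed d c35 (torusGeom d n N L M dist) Bg (fun j => fineKernelOf … (F j))`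
((3.49) likewise); the identifications `A j 0 (U j) = G j`, `A j 1 (U j) = (G j·D)ᵀ`, `F j 3 (U j) = N_j` and the
operator model.  CONCLUSION: there are thresholds `M₁, a₀ > 0` (the max / min of the two printed blocks) and a
decay ceiling `δ⋆ = min(δ₀, δ₁/2) > 0` such that for every `0 ≤ δ < δ⋆` a constant `C ≥ 0` (=
`C_A(1 + C_A·C_P)` of `sliceKernel_bound_torus_of_printedType` with the printed `B₀, δ₀, C₃, δ₁`) bounds EVERY
slice in King's (3.63) shape AS SOON AS `M₁ ≤ M`, `Mα₀ ≤ a₀` and every `U j` is in the class (3.35) with `α₀`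
— the print's own conditions, now visible in the type.  HONEST: whether `Thm31Printed`/`Stmt349Printed` HOLD for
the family of auxiliary propagators of the resolvent telescoping (reading (I′)/(I″): Theorem 3.1 is printed for
`G′(U)` of ONE domain sequence; the constants' independence of `{Ω_j}` is p. 399) is the hypothesis of the NE3
node; this theorem only makes the hypothesis THE PRINTED STATEMENT BY NAME. [folklore] -/
theorem sliceKernel_bound_torus_of_printedStatements (M c35 : ℝ) (Bg : ℕ → B9.Backgrounds)
    (U : ∀ j, (Bg j).Cfg)
    (A F : ∀ j : ℕ, Fin 4 → (Bg j).Cfg → Matrix (TPt d (N * L ^ n)) (TPt d (N * L ^ n)) ℝ)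
    (G Ng K : ℕ → Matrix (TPt d (N * L ^ n)) (TPt d (N * L ^ n)) ℝ)
    (D : Matrix (TPt d (N * L ^ n)) (TPt d (N * L ^ n)) ℝ)
    (τ : ℕ → TPt d (N * L ^ n) → TPt d (N * L ^ n) → ℝ) (am : ℕ → ℝ)
    (dist : ∀ j : ℕ, TPt d (levM n N L j) → TPt d (levM n N L j) → ℝ) {a : ℝ}
    (hd : 1 ≤ d) (ha : 0 ≤ a) (hbd : ∀ j y y₁, (nbd d n N L j y y₁ : ℝ) ≤ dist j y y₁)
    (hT31 : B9.Thm31Printed c35 (fun j => torusGeom d n N L M dist j) Bg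
      (fun j => matrixFamily (cube d n N L j) (dist j) j (L : ℝ) M (A j)))
    (hT349 : B9.Stmt349Printed d c35 (fun j => torusGeom d n N L M dist j) Bg
      (fun j => fineKernelOf (cube d n N L j) (dist j) j (L : ℝ) M (F j)))
    (hA0 : ∀ j, A j 0 (U j) = G j) (hA1 : ∀ j, A j 1 (U j) = (G j * D).transpose)
    (hF3 : ∀ j, F j 3 (U j) = Ng j)
    (hτ : ∀ j z w, |τ j z w| ≤ 1) (ham : ∀ j, 0 ≤ am j ∧ am j ≤ a)
    (hK : ∀ j, K j = massKernel (cube d n N L j) (τ j) (am j / ((L : ℝ) ^ j) ^ (d + 2)) + Ng j) :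
    ∃ M₁ a₀ δs : ℝ, 0 < M₁ ∧ 0 < a₀ ∧ 0 < δs ∧
      ∀ δ : ℝ, 0 ≤ δ → δ < δs → ∃ C : ℝ, 0 ≤ C ∧
        (M₁ ≤ M → ∀ α₀ : ℝ, 0 < α₀ → M * α₀ ≤ a₀ → (∀ j, (Bg j).Reg335 c35 α₀ (U j)) →
          ∀ i x y, |sliceKernel G K D i x y|
            ≤ C * (Real.exp (-(δ * (rho d n N L x y / (L : ℝ) ^ i))) / ((L : ℝ) ^ i) ^ (d - 1))) := by
  obtain ⟨M₁, δ₀, a₀, B₀, Bβ, Bε, Bεβ, hM₁, hδ₀, ha₀, hB₀, h31⟩ := hT31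
  obtain ⟨M₁', δ₁, a₀', C₃, hM₁', hδ₁, ha₀', hC₃, h49⟩ := hT349
  have hL : (1 : ℝ) ≤ L := by exact_mod_cast one_le_L L
  refine ⟨max M₁ M₁', min a₀ a₀', min δ₀ (δ₁ / 2), lt_max_of_lt_left hM₁, lt_min ha₀ ha₀',
    lt_min hδ₀ (by linarith), fun δ hδ hδs => ?_⟩
  have hδ₀' : δ < δ₀ := lt_of_lt_of_le hδs (min_le_left _ _)
  have hδ₁' : δ ≤ δ₁ / 2 := (lt_of_lt_of_le hδs (min_le_right _ _)).le
  refine ⟨printedCA B₀ δ₀ δ d ((2 : ℝ) ^ d) d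
      * (1 + printedCA B₀ δ₀ δ d ((2 : ℝ) ^ d) d * printedCP a C₃ δ₁ δ L d d), ?_, ?_⟩
  · have h1 : 0 ≤ printedCA B₀ δ₀ δ d ((2 : ℝ) ^ d) d := printedCA_nonneg hB₀.le (by positivity) hδ₀'
    have h2 : 0 ≤ printedCP a C₃ δ₁ δ (L : ℝ) d d := printedCP_nonneg ha hC₃.le hL
    positivity
  · intro hM α₀ hα₀ hMa hreg i x y
    have h342 : ∀ j, B9.Ineq342_346_347
        (matrixFamily (cube d n N L j) (dist j) j (L : ℝ) M (A j)) B₀ δ₀ (U j) :=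
      fun j => (h31 j (le_trans (le_max_left _ _) hM) α₀ hα₀ (le_trans hMa (min_le_left _ _)) (U j)
        (hreg j)).1
    have h349 : ∀ j, B9.Ineq349 d
        (fineKernelOf (cube d n N L j) (dist j) j (L : ℝ) M (F j)) C₃ δ₁ (U j) :=
      fun j => h49 j (le_trans (le_max_right _ _) hM) α₀ hα₀ (le_trans hMa (min_le_right _ _)) (U j) (hreg j)
    exact sliceKernel_bound_torus_of_printedType d n N L M dist Bg U A F G Ng K D τ am hd hB₀.le hC₃.le hδ hδ₀'
      hδ₁' ha hbd hA0 hA1 hF3 h342 h349 hτ ham hK i x y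

end PrintedStatements

/-! ## §7  THE NE3 SKELETON END TO END ON THE TORUS: `NE3Shape` from the printed statements BY NAME (stability
side), the located consistency readings (gen 7/8, unchanged) and the operator model — every remaining hypothesis
visible in one type -/
section Skeleton

variable (d N L : ℕ) [NeZero N] [NeZero L]

/-- **NE3's typed skeleton in one theorem (torus, printed statements by name).**  Level `k` of the RG run lives on
the fine torus `X k = (ℤ/NL^k)^d` with the nested block structure of §4 (`n := k`); the slices are the resolvent
slices `sliceKernel (G k V) (K k V) (D k V) i` of the auxiliary propagators.  STABILITY HYPOTHESES = the literature
seat's `B9.Thm31Printed` and `B9.Stmt349Printed` for the family indexed by `(k, V, j)` of matrix carriers over the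
torus block geometries (ONE threshold block `M₁, δ₀, a₀, B₀` / `M₁, δ₀, a₀, C` for the whole family — «dependent on
d and L only», p. 397, «do not depend on the sequence {Ω_j}», p. 399), the identifications `A = G`, `(G·D)ᵀ`, `N`, the operator model `hK`, and `hbd` for a
free dominating site distance; CONSISTENCY HYPOTHESES = exactly those of `T4SliceTelescoping.ne3Shape_of_slices_rpow`
(face sets `F k` with diameter and shell-count bounds, the readings `z dl sig blk lam t osc nrm pair` with their
located inequalities, `OneStepCorrectionRate`), with the integer metric `npl1 (x − y)` (`hzero`, `htri` PROVED
here).  CONCLUSION: printed thresholds `M₁, a₀ > 0` exist such that, once `M₁ ≤ M`, `Mα₀ ≤ a₀` and every background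
`U k V j` (`V ∈ dom`) is in the class (3.35), `NE3Shape R C′ (L^{−a})` holds for some constant `C′`.  HONEST: a
SKELETON — every analytic input is a hypothesis; that the printed statements hold for THIS family is reading
(I′)/(I″); the consistency readings are the located, unprinted items of the records; NE3 is NOT proved. [folklore] -/
theorem ne3Shape_torus_of_printedStatements {ι : Type} {Xr : Type*} [Fintype Xr] {R : Readings ι Xr} (M c35 : ℝ)
    (Bg : ℕ → ι → ℕ → B9.Backgrounds) (U : ∀ k V j, (Bg k V j).Cfg)
    (dist : ∀ k j : ℕ, TPt d (levM k N L j) → TPt d (levM k N L j) → ℝ)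
    (A Fk : ∀ (k : ℕ) (V : ι) (j : ℕ), Fin 4 → (Bg k V j).Cfg →
      Matrix (TPt d (N * L ^ k)) (TPt d (N * L ^ k)) ℝ)
    (G Ng K : ∀ k : ℕ, ι → ℕ → Matrix (TPt d (N * L ^ k)) (TPt d (N * L ^ k)) ℝ)
    (D : ∀ k : ℕ, ι → Matrix (TPt d (N * L ^ k)) (TPt d (N * L ^ k)) ℝ)
    (τ : ∀ k : ℕ, ι → ℕ → TPt d (N * L ^ k) → TPt d (N * L ^ k) → ℝ) (am : ℕ → ι → ℕ → ℝ)
    (F : ∀ k : ℕ, Finset (TPt d (N * L ^ k))) (Nn : ℕ → ℕ)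
    {z dl sig blk lam t osc nrm pair : ℕ → ι → ℝ} {Af ℓ CJ CB B CPo CD B0 CR Γ Λr ρ₂ a amax : ℝ}
    (hL : 2 ≤ L) (ha0 : 0 < a) (ha : a < 1) (hAf : 0 ≤ Af) (hℓ : 1 ≤ ℓ) (hd : 2 ≤ d) (hamax : 0 ≤ amax)
    (hbd : ∀ k j y y₁, (nbd d k N L j y y₁ : ℝ) ≤ dist k j y y₁)
    (hT31 : B9.Thm31Printed c35 (fun p : ℕ × ι × ℕ => torusGeom d p.1 N L M (dist p.1) p.2.2)
      (fun p : ℕ × ι × ℕ => Bg p.1 p.2.1 p.2.2)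
      (fun p : ℕ × ι × ℕ =>
        matrixFamily (cube d p.1 N L p.2.2) (dist p.1 p.2.2) p.2.2 (L : ℝ) M (A p.1 p.2.1 p.2.2)))
    (hT349 : B9.Stmt349Printed d c35 (fun p : ℕ × ι × ℕ => torusGeom d p.1 N L M (dist p.1) p.2.2)
      (fun p : ℕ × ι × ℕ => Bg p.1 p.2.1 p.2.2)
      (fun p : ℕ × ι × ℕ =>
        fineKernelOf (cube d p.1 N L p.2.2) (dist p.1 p.2.2) p.2.2 (L : ℝ) M (Fk p.1 p.2.1 p.2.2)))
    (hA0 : ∀ k V j, A k V j 0 (U k V j) = G k V j)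
    (hA1 : ∀ k V j, A k V j 1 (U k V j) = (G k V j * D k V).transpose)
    (hF3 : ∀ k V j, Fk k V j 3 (U k V j) = Ng k V j)
    (hτ : ∀ k V j z w, |τ k V j z w| ≤ 1) (ham : ∀ k V j, 0 ≤ am k V j ∧ am k V j ≤ amax)
    (hK : ∀ k V j, K k V j = massKernel (cube d k N L j) (τ k V j) (am k V j / ((L : ℝ) ^ j) ^ (d + 2)) + Ng k V j)
    (hFN : ∀ k (x : TPt d (N * L ^ k)), ∀ y ∈ F k, npl1 (x - y) ≤ Nn k) (hN : ∀ k, (Nn k : ℝ) ≤ ℓ * (L : ℝ) ^ k)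
    (hcard : ∀ k (x : TPt d (N * L ^ k)) (r : ℕ), 1 ≤ r →
      (((F k).filter fun y => npl1 (x - y) = r).card : ℝ) ≤ Af * (r : ℝ) ^ (d - 2))
    (hdl : ∀ k, ∀ V ∈ R.dom, ∃ x : TPt d (N * L ^ k),
      dl k V ≤ ∑ y ∈ F k, |∑ i ∈ Finset.range (k + 1), sliceKernel (G k V) (K k V) (D k V) i x y|)
    (h1 : ∀ k : ℕ, ∀ V ∈ R.dom, z k V ≤ dl k V * sig k V + blk k V)
    (h3 : ∀ k : ℕ, ∀ V ∈ R.dom, 0 ≤ sig k V ∧ sig k V ≤ CJ * lam k V)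
    (h4 : ∀ k : ℕ, ∀ V ∈ R.dom, 0 ≤ blk k V ∧ blk k V ≤ CB * (1 + k * Real.log L) * lam k V)
    (h5 : ∀ k : ℕ, ∀ V ∈ R.dom, 0 ≤ lam k V ∧ lam k V ≤ B * ((L : ℝ)⁻¹ ^ k) ^ 3)
    (hCJ : 0 ≤ CJ) (hCB : 0 ≤ CB) (hCPo : 0 ≤ CPo) (hCD : 0 ≤ CD) (hB : 0 ≤ B) (hB0 : 0 ≤ B0) (hCR : 0 ≤ CR)
    (hΓ : 0 ≤ Γ) (hΛr : 0 ≤ Λr) (hρ₂ : 0 ≤ ρ₂)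
    (ht : ∀ k : ℕ, ∀ V ∈ R.dom, t k V ≤ B0 * CR * (L : ℝ)⁻¹ ^ k)
    (hosc : ∀ k : ℕ, ∀ V ∈ R.dom, osc k V ≤ (1 + CD) * (1 + CPo) * z k V / ((L : ℝ)⁻¹ ^ k) ^ 2 + t k V)
    (hact : ∀ k : ℕ, ∀ V ∈ R.dom, R.act k V = ∑ x, R.loc k V x) (hvol : (Fintype.card Xr : ℝ) ≤ R.vol)
    (hread : ∀ k : ℕ, ∀ V ∈ R.dom, ∀ x : Xr,
      |R.loc (k + 1) V x - R.loc k V x| ≤ Λr * nrm k V + pair k V)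
    (hresp : ∀ k : ℕ, ∀ V ∈ R.dom, nrm k V ≤ Γ * osc k V)
    (hpair : OneStepCorrectionRate R.dom pair ρ₂ ((L : ℝ) ^ (-a))) :
    ∃ M₁ a₀ : ℝ, 0 < M₁ ∧ 0 < a₀ ∧
      (M₁ ≤ M → ∀ α₀ : ℝ, 0 < α₀ → M * α₀ ≤ a₀ →
        (∀ k V j, V ∈ R.dom → (Bg k V j).Reg335 c35 α₀ (U k V j)) →
          ∃ C' : ℝ, NE3Shape R C' ((L : ℝ) ^ (-a))) := by
  obtain ⟨M₁, δ₀, a₀, B₀, Bβ, Bε, Bεβ, hM₁, hδ₀, ha₀, hB₀, h31⟩ := hT31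
  obtain ⟨M₁', δ₁, a₀', C₃, hM₁', hδ₁, ha₀', hC₃, h49⟩ := hT349
  refine ⟨max M₁ M₁', min a₀ a₀', lt_max_of_lt_left hM₁, lt_min ha₀ ha₀', fun hM α₀ hα₀ hMa hreg => ?_⟩
  -- the decay rate of the slices: any `0 < δ < min(δ₀, δ₁/2)`
  set δ : ℝ := min δ₀ (δ₁ / 2) / 2 with hδdef
  have hδpos : 0 < δ := by
    have : 0 < min δ₀ (δ₁ / 2) := lt_min hδ₀ (by linarith)
    rw [hδdef]; linarith
  have hδ₀' : δ < δ₀ := by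
    have h1 : min δ₀ (δ₁ / 2) ≤ δ₀ := min_le_left _ _
    have : 0 < min δ₀ (δ₁ / 2) := lt_min hδ₀ (by linarith)
    rw [hδdef]; linarith
  have hδ₁' : δ ≤ δ₁ / 2 := by
    have h1 : min δ₀ (δ₁ / 2) ≤ δ₁ / 2 := min_le_right _ _
    have : 0 < min δ₀ (δ₁ / 2) := lt_min hδ₀ (by linarith)
    rw [hδdef]; linarith
  have hLr : (1 : ℝ) ≤ L := by exact_mod_cast one_le_L L
  -- the level-free slice constant
  set C : ℝ := printedCA B₀ δ₀ δ d ((2 : ℝ) ^ d) d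
      * (1 + printedCA B₀ δ₀ δ d ((2 : ℝ) ^ d) d * printedCP amax C₃ δ₁ δ L d d) with hCdef
  have hC : 0 ≤ C := by
    have h1 : 0 ≤ printedCA B₀ δ₀ δ d ((2 : ℝ) ^ d) d := printedCA_nonneg hB₀.le (by positivity) hδ₀'
    have h2 : 0 ≤ printedCP amax C₃ δ₁ δ (L : ℝ) d d := printedCP_nonneg hamax hC₃.le hLr
    rw [hCdef]; positivity
  -- the printed statements, instantiated: (3.42)/(3.49) of printed TYPE per (k, V ∈ dom, j)
  have h342 : ∀ k, ∀ V ∈ R.dom, ∀ j, B9.Ineq342_346_347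
      (matrixFamily (cube d k N L j) (dist k j) j (L : ℝ) M (A k V j)) B₀ δ₀ (U k V j) :=
    fun k V hV j => (h31 (k, V, j) (le_trans (le_max_left _ _) hM) α₀ hα₀
      (le_trans hMa (min_le_left _ _)) (U k V j) (hreg k V j hV)).1
  have h349 : ∀ k, ∀ V ∈ R.dom, ∀ j, B9.Ineq349 d
      (fineKernelOf (cube d k N L j) (dist k j) j (L : ℝ) M (Fk k V j)) C₃ δ₁ (U k V j) :=
    fun k V hV j => h49 (k, V, j) (le_trans (le_max_right _ _) hM) α₀ hα₀
      (le_trans hMa (min_le_right _ _)) (U k V j) (hreg k V j hV)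
  -- the slice bounds `hg` on every torus level, integer metric `npl1`
  have hg : ∀ k, ∀ V ∈ R.dom, ∀ i < k + 1, ∀ x y : TPt d (N * L ^ k),
      |sliceKernel (G k V) (K k V) (D k V) i x y|
        ≤ C * (Real.exp (-(δ * ((npl1 (x - y) : ℝ) / (L : ℝ) ^ i))) / ((L : ℝ) ^ i) ^ (d - 1)) := by
    intro k V hV i _ x y
    rw [cast_npl1]
    exact sliceKernel_bound_torus_of_printedType d k N L M (dist k) (Bg k V) (U k V) (A k V) (Fk k V) (G k V)
      (Ng k V) (K k V) (D k V) (τ k V) (am k V) (by omega) hB₀.le hC₃.le hδpos.le hδ₀' hδ₁' hamax (hbd k)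
      (hA0 k V) (hA1 k V) (hF3 k V) (h342 k V hV) (h349 k V hV) (hτ k V) (ham k V) (hK k V) i x y
  exact ⟨_, ne3Shape_of_slices_rpow F (fun k x y => npl1 (x - y))
    (fun k V i => sliceKernel (G k V) (K k V) (D k V) i) Nn (by exact_mod_cast hL) ha0 ha hδpos hC hAf hℓ hd
    (fun k x y h => eq_of_npl1_sub_eq_zero h) hFN hN hcard hg hdl h1 h3 h4 h5 hCJ hCB hCPo hCD hB hB0 hCR hΓ
    hΛr hρ₂ ht hosc hact hvol hread hresp hpair⟩

end Skeleton

end Summit.QuantumFields.BalabanUV.T4Continuum.SliceTorusSkeleton
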